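import Mathlib
import Literature.AlgebraicGeometry.Resolution.CobordantGame
import Summits.ResolutionOfSingularities.ResolutionOfSingularities.Theorems.WeightedInvariantLocalWeightedDropPlaneWon
import Summits.ResolutionOfSingularities.ResolutionOfSingularities.Theorems.WeightedInvariantLocalWeightedDropTerminalDoublePointsAux
import Summits.ResolutionOfSingularities.ResolutionOfSingularities.Theorems.WeightedInvariantLocalWeightedDropTerminalDoublePoints
import Summits.ResolutionOfSingularities.ResolutionOfSingularities.Theorems.WeightedInvariantLocalWeightedDropInsepPointStep
import Summits.ResolutionOfSingularities.ResolutionOfSingularities.Theorems.WeightedInvariantLocalWeightedDropInsepXChange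

/-!
# `WeightedInvariant.LocalWeightedDrop`, line `hasse-ridge-face-selection`: the TERMINAL EXITS of the class INSEP read after a
# formal change of the old variables / modulo squares

Crux item stmt-ResolutionOfSingularities-8899 `LocalWeightedDrop` (route `ResolutionOfSingularities/WeightedInvariant`),
serving the door `WeightedConstruction` stmt-ResolutionOfSingularities-0571.  [OURS · L1 W4.3, chain w43, stub worker 3
(gen 2): unit (u5) of CRUX-PLAN v2 §v2.3 under DECISION (D4) of CHAIN v3 («terminal / monomial exits are read in SOME formal
coordinates of `k[[x₁,x₂]]` and transported by `won_subst_iff`»), for the piece S2iM `stub_charTwoInseparableReductionWon`;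
NOT a statement of any manuscript.]

* `won_dp_of_terminal_xChange`: if `θ^* A₀` is terminal for some formal change `θ` of `k[[x₀,x₁]]` (`θ(0) = 0`, invertible
  linear part), then `y² + A₀` is won (`InsepDoublePoint.won_Xpow_add_xChange_iff` + `terminalDoublePointWon`);
* `won_dp_of_binomial_add_sq`: if `A₀ + φ² = x₀^r x₁^s · U` (`φ(0) = 0`, `U(0) ≠ 0`, `(r,s) ∉ 2ℕ²`) — Hauser–Wagner's «`f` is a
  monomial in `Q = R/R²`» — then `y² + A₀` is won (`won_dp_add_sq_iff` + `binomialDoublePointWon`);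
* `won_dp_of_binomial_xChange_add_sq`: both at once (`θ^* A₀ + φ²` a binomial).
Only the one-variable singular germs (`PlaneWon.lineWon`) enter.
-/

set_option linter.dupNamespace false -- mandated namespace of this single-conjunct summit

namespace Summit.ResolutionOfSingularities.ResolutionOfSingularities.Theorems

open Literature.AlgebraicGeometry.Resolution
open Literature.AlgebraicGeometry.Resolution.CobordantGame

open InsepDoublePoint TerminalDoublePoint MvPowerSeries in
/-- TERMINAL EXIT AFTER A FORMAL CHANGE OF THE OLD VARIABLES (characteristic `2`, `k` algebraically closed; unit (u5) / (D4)):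
if in SOME formal coordinates `θ` of `k[[x₀,x₁]]` the series `A₀` becomes terminal — `θ^* A₀ = x₀^r x₁^s · U`, `U(0) ≠ 0`,
`(r,s) ∉ 2ℕ²`, or `x_i^{2m} · g`, `m ≥ 1`, `ord g = 1` — then `y² + A₀` is won. -/
theorem won_dp_of_terminal_xChange (k : Type) [Field k] [CharP k 2] [IsAlgClosed k]
    (θ : Fin 2 → MvPowerSeries (Fin 2) k) (hθ0 : ∀ i, MvPowerSeries.constantCoeff (θ i) = 0)
    (hθdet : IsUnit (Matrix.det (Matrix.of fun i j => MvPowerSeries.coeff (Finsupp.single j 1) (θ i))))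
    (A₀ : MvPowerSeries (Fin 2) k)
    (hT : (∃ (r s : ℕ) (U : MvPowerSeries (Fin 2) k), MvPowerSeries.constantCoeff U ≠ 0 ∧ ¬ (2 ∣ r ∧ 2 ∣ s) ∧
            MvPowerSeries.subst θ A₀ = MvPowerSeries.X (0 : Fin 2) ^ r * MvPowerSeries.X (1 : Fin 2) ^ s * U) ∨
          (∃ (i : Fin 2) (m : ℕ) (g : MvPowerSeries (Fin 2) k), 0 < m ∧ g.order = 1 ∧
            MvPowerSeries.subst θ A₀ = MvPowerSeries.X i ^ (2 * m) * g)) :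
    CobordantGame.Won k 3 (MvPowerSeries.X (Fin.last 2) ^ 2 + MvPowerSeries.rename (Fin.succAboveEmb (Fin.last 2)) A₀) :=
  (won_Xpow_add_xChange_iff 2 θ hθ0 hθdet A₀).mp
    (terminalDoublePointWon 2 Nat.prime_two k (fun g hg => PlaneWon.lineWon g hg) _ hT)

open InsepDoublePoint TerminalDoublePoint MvPowerSeries in
/-- TERMINAL EXIT MODULO SQUARES (characteristic `2`, `k` algebraically closed; Hauser–Wagner's «`f` is a monomial in
`Q = R/R²`», unit (u5)): if `A₀ + φ² = x₀^r x₁^s · U` with `φ(0) = 0`, `U(0) ≠ 0`, `(r,s) ∉ 2ℕ²`, then `y² + A₀` is won. -/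
theorem won_dp_of_binomial_add_sq (k : Type) [Field k] [CharP k 2] [IsAlgClosed k]
    (A₀ φ U : MvPowerSeries (Fin 2) k) (hφ : MvPowerSeries.constantCoeff φ = 0) (hU : MvPowerSeries.constantCoeff U ≠ 0)
    (r s : ℕ) (hrs : ¬ (2 ∣ r ∧ 2 ∣ s))
    (h : A₀ + φ ^ 2 = MvPowerSeries.X (0 : Fin 2) ^ r * MvPowerSeries.X (1 : Fin 2) ^ s * U) :
    CobordantGame.Won k 3 (MvPowerSeries.X (Fin.last 2) ^ 2 + MvPowerSeries.rename (Fin.succAboveEmb (Fin.last 2)) A₀) := by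
  refine (won_dp_add_sq_iff φ hφ A₀).mp ?_
  rw [h]
  exact binomialDoublePointWon 2 Nat.prime_two k (fun g hg => PlaneWon.lineWon g hg) (r + s) r s U le_rfl hU hrs

open InsepDoublePoint TerminalDoublePoint MvPowerSeries in
/-- TERMINAL EXIT MODULO SQUARES IN SOME FORMAL COORDINATES (characteristic `2`, `k` algebraically closed): if
`θ^* A₀ + φ² = x₀^r x₁^s · U` (`θ` a formal change of `k[[x₀,x₁]]`, `φ(0) = 0`, `U(0) ≠ 0`, `(r,s) ∉ 2ℕ²`), then `y² + A₀` is
won. -/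
theorem won_dp_of_binomial_xChange_add_sq (k : Type) [Field k] [CharP k 2] [IsAlgClosed k]
    (θ : Fin 2 → MvPowerSeries (Fin 2) k) (hθ0 : ∀ i, MvPowerSeries.constantCoeff (θ i) = 0)
    (hθdet : IsUnit (Matrix.det (Matrix.of fun i j => MvPowerSeries.coeff (Finsupp.single j 1) (θ i))))
    (A₀ φ U : MvPowerSeries (Fin 2) k) (hφ : MvPowerSeries.constantCoeff φ = 0) (hU : MvPowerSeries.constantCoeff U ≠ 0)
    (r s : ℕ) (hrs : ¬ (2 ∣ r ∧ 2 ∣ s))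
    (h : MvPowerSeries.subst θ A₀ + φ ^ 2 = MvPowerSeries.X (0 : Fin 2) ^ r * MvPowerSeries.X (1 : Fin 2) ^ s * U) :
    CobordantGame.Won k 3 (MvPowerSeries.X (Fin.last 2) ^ 2 + MvPowerSeries.rename (Fin.succAboveEmb (Fin.last 2)) A₀) :=
  (won_Xpow_add_xChange_iff 2 θ hθ0 hθdet A₀).mp (won_dp_of_binomial_add_sq k _ φ U hφ hU r s hrs h)

end Summit.ResolutionOfSingularities.ResolutionOfSingularities.Theorems
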